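import Summits.ABC.StewartYu.RecordNumericC
import HarnessLib

/-!
# Cell abc-stewartyu, Gen-3 record (WP-M3.R, odd `p`): MONOTONICITY of the record predicate `RecordOdd` in `Vmax`
# (the datum's height bound) — the odd twin of `recordTwo_mono_Vmax` (`PadicG3TwoParTwo`, p489357)

`Summits/ABC/StewartYu/RecordOddMono.lean` — cell `abc-stewartyu` (HOME `run/shared/lean/pub/abc-stewartyu/`),
route `PadicPrimesKummerThird`, crux `Y07Odd` (stmt-ABC-19658); seat lp-1 (g3).  Theorems only.

The record of a datum is built with the height bound `Amax := min Vmax (2ⁿ·∏ⱼVⱼ)` (`≥` every `Vⱼ` since all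
`Vⱼ ≥ 1`, and `≤ 2ⁿ·Ω` — lp-1's instantiation hypothesis `hAmax` for free, exactly as at `p = 2`, `parTwo`);
the record predicate is then lifted from `Amax` to the datum's `Vmax ≥ Amax` by **`recordOdd_mono_Vmax`**:
clauses (A)/(B) do not see `Vmax`; in clause (C) `Vmax` enters as `log Vmax` on the left with the coefficient
`C r·P(κ)` and inside `log(2 Vmax)` on the right with the coefficient `C n·∏V`, and (C) itself forces
`C r·P(κ) ≤ C n·∏V` (all the other left-hand terms dominate the right-hand ones), so it is monotone upward.
Also `le_two_pow_mul_prod_of_one_le` (`Vⱼ ≤ 2ⁿ·∏V`), for the `Amax := min Vmax (2ⁿ∏V)` records.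

References: Yu. V. Nesterenko, LNM 1819 (2003), §5.2 (5.22).
-/

noncomputable section

open Finset

namespace Summit.ABC.StewartYu

namespace GenThreeFrameSpecOdd

/-- **`RecordOdd` is monotone UPWARD in `Vmax`** (for `Vmax ≥ 1`, `W ≥ 0`, weights `≥ 1`, `0 ≤ C r`).
[cite: Nesterenko2003, §5.2 (5.22); shape only] -/
theorem recordOdd_mono_Vmax {C : ℕ → ℝ} (hC : ∀ r, 0 ≤ C r) {p n : ℕ} (hn : 1 ≤ n) {V : Fin n → ℝ}
    (hV1 : ∀ j, 1 ≤ V j) {Vmax Vmax' W : ℝ} (hW : 0 ≤ W) (hVmax1 : 1 ≤ Vmax) (hle : Vmax ≤ Vmax')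
    {D₀ S₀ X : ℕ} {D : Fin n → ℕ} (h : RecordOdd C p n V Vmax W D₀ S₀ X D) :
    RecordOdd C p n V Vmax' W D₀ S₀ X D := by
  obtain ⟨hA, hB, hCl⟩ := h
  refine ⟨hA, hB, ?_⟩
  intro r d₀ M hr0 hrn hd₀ hM hineq κ hκ hdet
  have h1 := hCl r d₀ M hr0 hrn hd₀ hM hineq κ hκ hdet
  have hP1 := RecordExits.one_le_P hn M hV1 κ hdet
  -- the selection's weight `P(κ)` and the two sides' coefficients
  obtain ⟨P, hPdef⟩ : ∃ P : ℝ, P = ((r.factorial : ℝ)) ^ 2 * (n : ℝ) ^ r *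
      (|(Matrix.of fun i j => (M j (κ i) : ℝ)).det| * ∏ i, V (κ i)) := ⟨_, rfl⟩
  rw [← hPdef] at hP1 h1 ⊢
  obtain ⟨a, ha⟩ : ∃ a : ℝ, a = C r * P := ⟨_, rfl⟩
  obtain ⟨b, hb⟩ : ∃ b : ℝ, b = C n * ∏ j, V j := ⟨_, rfl⟩
  have ha0 : 0 ≤ a := by rw [ha]; exact mul_nonneg (hC r) (by linarith)
  have hb0 : 0 ≤ b := by rw [hb]; exact mul_nonneg (hC n) (Finset.prod_nonneg fun j _ => by linarith [hV1 j])
  have hn1 : (1 : ℝ) ≤ n := by exact_mod_cast hn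
  have hlog3 : Real.log 2 ≤ Real.log 3 := Real.log_le_log (by norm_num) (by norm_num)
  have hlog2 : 0 < Real.log 2 := Real.log_pos (by norm_num)
  have hlogn : 0 ≤ Real.log n := Real.log_nonneg hn1
  have hlogP : 0 ≤ Real.log P := Real.log_nonneg hP1
  have hlog2P : 0 ≤ Real.log (2 * P) := Real.log_nonneg (by linarith)
  have hlogp : 0 ≤ Real.log p := Real.log_natCast_nonneg p
  have hlogV : 0 ≤ Real.log Vmax := Real.log_nonneg hVmax1
  have hVpos : 0 < Vmax := by linarith
  have hV'pos : 0 < Vmax' := by linarith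
  have hδ : Real.log Vmax ≤ Real.log Vmax' := Real.log_le_log hVpos hle
  have e1 : Real.log (2 * Vmax) = Real.log 2 + Real.log Vmax := Real.log_mul (by norm_num) hVpos.ne'
  have e2 : Real.log (2 * Vmax') = Real.log 2 + Real.log Vmax' := Real.log_mul (by norm_num) hV'pos.ne'
  -- `h1` in the letters `a`, `b`
  have h1' : a * (W + Real.log 3 + Real.log n + Real.log Vmax + Real.log P + Real.log p + Real.log (2 * P)) ≤
      b * (W + Real.log p + Real.log 2 + Real.log Vmax) := by
    have h1'' := h1
    rw [e1, ← add_assoc] at h1''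
    rw [ha, hb]
    simpa only [mul_assoc] using h1''
  -- `a ≤ b`
  have hab : a ≤ b := by
    by_contra hlt
    push Not at hlt
    have hpos : 0 < W + Real.log p + Real.log 2 + Real.log Vmax := by linarith
    have h2 : b * (W + Real.log p + Real.log 2 + Real.log Vmax) <
        a * (W + Real.log p + Real.log 2 + Real.log Vmax) := mul_lt_mul_of_pos_right hlt hpos
    have h3 : a * (W + Real.log p + Real.log 2 + Real.log Vmax) ≤
        a * (W + Real.log 3 + Real.log n + Real.log Vmax + Real.log P + Real.log p + Real.log (2 * P)) :=
      mul_le_mul_of_nonneg_left (by linarith) ha0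
    linarith
  -- conclusion
  rw [e2]
  have hδ0 : 0 ≤ Real.log Vmax' - Real.log Vmax := by linarith
  calc C r * P * (W + Real.log 3 + Real.log n + Real.log Vmax' + Real.log P + Real.log p + Real.log (2 * P))
      = a * (W + Real.log 3 + Real.log n + Real.log Vmax + Real.log P + Real.log p + Real.log (2 * P)) +
          a * (Real.log Vmax' - Real.log Vmax) := by rw [ha]; ring
    _ ≤ b * (W + Real.log p + Real.log 2 + Real.log Vmax) + b * (Real.log Vmax' - Real.log Vmax) := by
        have h4 : a * (Real.log Vmax' - Real.log Vmax) ≤ b * (Real.log Vmax' - Real.log Vmax) :=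
          mul_le_mul_of_nonneg_right hab hδ0
        linarith
    _ = C n * (∏ j, V j) * (W + Real.log p + (Real.log 2 + Real.log Vmax')) := by rw [hb]; ring

/-- Every weight is below `2ⁿ·∏ⱼ Vⱼ` when all weights are `≥ 1`. [folklore] -/
theorem le_two_pow_mul_prod_of_one_le {n : ℕ} {V : Fin n → ℝ} (hV1 : ∀ j, 1 ≤ V j) (j : Fin n) :
    V j ≤ 2 ^ n * ∏ i, V i := by
  have hprod : V j ≤ ∏ i, V i := by
    rw [← Finset.mul_prod_erase Finset.univ V (Finset.mem_univ j)]
    have h1 : 1 ≤ ∏ i ∈ Finset.univ.erase j, V i := Finset.one_le_prod fun i _ => hV1 i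
    have h0 : 0 ≤ V j := by linarith [hV1 j]
    exact le_mul_of_one_le_right h0 h1
  have h2 : (1 : ℝ) ≤ 2 ^ n := one_le_pow₀ (by norm_num)
  have h3 : 0 ≤ ∏ i, V i := Finset.prod_nonneg fun i _ => by linarith [hV1 i]
  calc V j ≤ ∏ i, V i := hprod
    _ = 1 * ∏ i, V i := (one_mul _).symm
    _ ≤ 2 ^ n * ∏ i, V i := mul_le_mul_of_nonneg_right h2 h3

/-- `aʳ·Q ≤ aⁿ·R` with `0 < a ≤ c`, `r ≤ n`, `R ≥ 0` gives `cʳ·Q ≤ cⁿ·R`. [folklore] -/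
theorem pow_mul_le_pow_mul_of_le {a c Q R : ℝ} (ha : 0 < a) (hac : a ≤ c) {r n : ℕ} (hrn : r ≤ n)
    (hR : 0 ≤ R) (h : a ^ r * Q ≤ a ^ n * R) : c ^ r * Q ≤ c ^ n * R := by
  have hq : 1 ≤ c / a := by rw [le_div_iff₀ ha, one_mul]; exact hac
  have hq0 : 0 ≤ c / a := by linarith
  have ec : c = c / a * a := by field_simp
  have e1 : c ^ r = (c / a) ^ r * a ^ r := by rw [← mul_pow, ← ec]
  have e2 : c ^ n = (c / a) ^ n * a ^ n := by rw [← mul_pow, ← ec]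
  have hqr : 0 ≤ (c / a) ^ r := pow_nonneg hq0 r
  have hqrn : (c / a) ^ r ≤ (c / a) ^ n := pow_le_pow_right₀ hq hrn
  have han : 0 ≤ a ^ n * R := mul_nonneg (pow_nonneg ha.le n) hR
  calc c ^ r * Q = (c / a) ^ r * (a ^ r * Q) := by rw [e1]; ring
    _ ≤ (c / a) ^ r * (a ^ n * R) := mul_le_mul_of_nonneg_left h hqr
    _ ≤ (c / a) ^ n * (a ^ n * R) := mul_le_mul_of_nonneg_right hqrn han
    _ = c ^ n * R := by rw [e2]; ring

/-- **`RecordOdd` is monotone UPWARD in the growth constant**: `RecordOdd (a^·) → RecordOdd (c^·)` for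
`1 ≤ a ≤ c` (clauses (A)/(B) do not see the constant; in clause (C), `aʳ·Q ≤ aⁿ·R` with `R ≥ 0` and `r < n`
gives `cʳ·Q = (c/a)ʳ·aʳ·Q ≤ (c/a)ʳ·aⁿ·R ≤ (c/a)ⁿ·aⁿ·R = cⁿ·R`).  So the records filed at `256` serve every cell
constant `c ≥ 256` (planner g9 ruling R21-c, STATUS 2026-08-27T04:24:02Z). [cite: Nesterenko2003, §5.2 (5.22); shape only] -/
theorem recordOdd_mono_base {a c : ℝ} (ha : 1 ≤ a) (hac : a ≤ c) {p n : ℕ} {V : Fin n → ℝ}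
    (hV1 : ∀ j, 1 ≤ V j) {Vmax W : ℝ} (hW : 0 ≤ W) (hVmax1 : 1 ≤ Vmax)
    {D₀ S₀ X : ℕ} {D : Fin n → ℕ} (h : RecordOdd (fun m => a ^ m) p n V Vmax W D₀ S₀ X D) :
    RecordOdd (fun m => c ^ m) p n V Vmax W D₀ S₀ X D := by
  obtain ⟨hA, hB, hCl⟩ := h
  refine ⟨hA, hB, ?_⟩
  intro r d₀ M hr0 hrn hd₀ hM hineq κ hκ hdet
  have h1 := hCl r d₀ M hr0 hrn hd₀ hM hineq κ hκ hdet
  -- the right-hand side is nonnegative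
  have hΩ : 0 ≤ ∏ j, V j := Finset.prod_nonneg fun j _ => by linarith [hV1 j]
  have hlogp : 0 ≤ Real.log p := Real.log_natCast_nonneg p
  have hlog2V : 0 ≤ Real.log (2 * Vmax) := Real.log_nonneg (by linarith)
  have hR : 0 ≤ (∏ j, V j) * (W + Real.log p + Real.log (2 * Vmax)) := mul_nonneg hΩ (by linarith)
  have ha0 : 0 < a := by linarith
  simp only [mul_assoc] at h1 ⊢
  exact pow_mul_le_pow_mul_of_le ha0 hac hrn.le hR h1

end GenThreeFrameSpecOdd

end Summit.ABC.StewartYu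

end
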